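import Literature.NumberTheory.LFunctions.KhaleLemma65
import Literature.NumberTheory.LFunctions.KhaleLemma71
import HarnessLib

/-!
# Khale 2024, (8.1): `Re Σ_{j=0}^{4} b_j K_{χ^j}(1 + ijt) ≥ 0`

Topic `Literature/NumberTheory/LFunctions`.  Everything in this file is PROVED (theorems only; no
definition, no named fact).

T. Khale, arXiv:2210.06457v1, §8, display **(8.1)**: with `b₀, …, b₄` from (7.2) (or any non-negative
trigonometric polynomial `Σ_k b_k cos(kx) ≥ 0`) and `f ≥ 0` of compact support,
`Re Σ_{j=0}^{4} b_j K_{χ^j}(1 + ijt) = Σ_n Λ(n) n^{−1} f(log n) Σ_{j=0}^{4} b_j cos(j(t log n − arg χ(n))) ≥ 0`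
"By (7.1)" — the positivity that starts §§8–10 (the character twin of Ford's
`Re Σ_j b_j K(1 + ijt) ≥ 0`).  Here `K_ψ` is the tree's `khaleK ψ f`, `χ^j` the `j`-th power in the
group of Dirichlet characters modulo `q` (so `χ⁰ = χ₀`, whose `K` omits the `n` with `(n, q) > 1`,
exactly as in the source), and the terms with `(n, q) > 1` vanish for every `j`.

* `KhaleEq81.re_sum_khaleK_pow_nonneg` — **(8.1)** for every `χ` mod `q`, every `K`, `b` with
  `Σ_{k≤K} b_k cos(kx) ≥ 0`, every real `t`.

## References

* T. Khale, arXiv:2210.06457v1, (8.1) (p. 18), (7.1)–(7.2). [Khale2024]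
* K. Ford, *Zero-free regions for the Riemann zeta function* (2002), §7 (7.2). [Ford2002Millennium]
-/

noncomputable section

open Complex Real Finset
open scoped ArithmeticFunction.vonMangoldt

namespace Literature.NumberTheory.LFunctions

namespace KhaleEq81

variable {q : ℕ}

/-- The phase of one coprime `n`: for a unit `u` of `ZMod q` with `u = n` and real `t`,
`χ^j(n) · n^{−(1 + ijt)} = n^{−1} w^j` with `w = χ(u) n^{−it}`, `|w| = 1`. [folklore] -/
theorem term_eq (χ : DirichletCharacter ℂ q) {n : ℕ} (hn : 0 < n) (u : (ZMod q)ˣ) (hu : (u : ZMod q) = n)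
    (t : ℝ) (j : ℕ) :
    (χ ^ j) (n : ZMod q) * (n : ℂ) ^ (-(1 + (((j : ℝ) * t : ℝ) : ℂ) * I)) =
      (n : ℂ)⁻¹ * (χ u * (n : ℂ) ^ (-((t : ℂ) * I))) ^ j := by
  have hn0 : (n : ℂ) ≠ 0 := by exact_mod_cast hn.ne'
  rw [← hu, MulChar.pow_apply_coe, mul_pow]
  have e : -(1 + (((j : ℝ) * t : ℝ) : ℂ) * I) = (-1 : ℂ) + (j : ℕ) * (-((t : ℂ) * I)) := by
    push_cast; ring
  rw [e, Complex.cpow_add _ _ hn0, Complex.cpow_nat_mul, Complex.cpow_neg_one]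
  ring

/-- **Khale 2024, (8.1).**  For a Dirichlet character `χ` modulo `q`, `f ≥ 0` vanishing on `[x₀, ∞)`,
real `t`, and coefficients `b` with `Σ_{k ≤ K} b_k cos(kx) ≥ 0` for all `x`:
`0 ≤ Σ_{j=0}^{K} b_j Re K_{χ^j}(1 + ijt)`. [cite: Khale2024, (8.1)] -/
theorem re_sum_khaleK_pow_nonneg (χ : DirichletCharacter ℂ q) {f : ℝ → ℝ} {x₀ : ℝ}
    (hf0 : ∀ u, x₀ ≤ u → f u = 0) (hfnn : ∀ u, 0 ≤ f u) {K : ℕ} {b : ℕ → ℝ}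
    (hb : ∀ x : ℝ, 0 ≤ trigPoly K b x) (t : ℝ) :
    0 ≤ ∑ j ∈ Finset.range (K + 1),
      b j * (khaleK (χ ^ j) f (1 + (((j : ℝ) * t : ℝ) : ℂ) * I)).re := by
  classical
  -- truncate the `K`'s
  set N : ℕ := max ⌈Real.exp x₀⌉₊ 1 with hN
  have hN1 : 1 ≤ N := le_max_right _ _
  have hx : x₀ ≤ Real.log N := by
    have h1 : Real.exp x₀ ≤ N := (Nat.le_ceil _).trans (by exact_mod_cast le_max_left _ _)
    have := Real.log_le_log (Real.exp_pos x₀) h1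
    rwa [Real.log_exp] at this
  have hKsum : ∀ (ψ : DirichletCharacter ℂ q) (s : ℂ), khaleK ψ f s =
      ∑ n ∈ Finset.range N, ((Λ n : ℝ) : ℂ) * ψ (n : ZMod q) * (f (Real.log n) : ℂ) * (n : ℂ) ^ (-s) := by
    intro ψ s
    unfold khaleK
    refine tsum_eq_sum fun n hn ↦ ?_
    rw [Finset.mem_range, not_lt] at hn
    have hlog : x₀ ≤ Real.log n :=
      hx.trans (Real.log_le_log (by exact_mod_cast hN1) (by exact_mod_cast hn))
    simp [hf0 _ hlog]
  simp_rw [hKsum, Complex.re_sum, Finset.mul_sum]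
  rw [Finset.sum_comm]
  refine Finset.sum_nonneg fun n _ ↦ ?_
  -- one `n`
  by_cases hcop : n.Coprime q
  · rcases Nat.eq_zero_or_pos n with rfl | hn
    · simp
    obtain ⟨u, hu⟩ := (ZMod.isUnit_iff_coprime n q).2 hcop
    set w : ℂ := χ u * (n : ℂ) ^ (-((t : ℂ) * I)) with hw
    have hwnorm : ‖w‖ = 1 := by
      rw [hw, norm_mul, χ.unit_norm_eq_one u, one_mul, Complex.norm_natCast_cpow_of_pos hn]
      simp
    obtain ⟨ψ, hψ⟩ := (Complex.norm_eq_one_iff w).1 hwnorm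
    have hterm : ∀ j : ℕ, b j * (((Λ n : ℝ) : ℂ) * (χ ^ j) (n : ZMod q) * (f (Real.log n) : ℂ) *
        (n : ℂ) ^ (-(1 + (((j : ℝ) * t : ℝ) : ℂ) * I))).re =
        ((Λ n : ℝ) * f (Real.log n) / n) * (b j * Real.cos (j * ψ)) := by
      intro j
      have e1 : ((Λ n : ℝ) : ℂ) * (χ ^ j) (n : ZMod q) * (f (Real.log n) : ℂ) *
          (n : ℂ) ^ (-(1 + (((j : ℝ) * t : ℝ) : ℂ) * I)) =
          (((Λ n : ℝ) * f (Real.log n) / n : ℝ) : ℂ) * w ^ j := by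
        have := term_eq χ hn u hu t j
        rw [mul_assoc (((Λ n : ℝ) : ℂ) * (χ ^ j) (n : ZMod q)) , mul_comm ((f (Real.log n) : ℂ)),
          ← mul_assoc, mul_assoc ((Λ n : ℝ) : ℂ), this, ← hw]
        push_cast
        have hn0 : (n : ℂ) ≠ 0 := by exact_mod_cast hn.ne'
        field_simp
      have e2 : (w ^ j).re = Real.cos (j * ψ) := by
        rw [← hψ, ← Complex.exp_nat_mul, show (j : ℂ) * (ψ * I) = ((j * ψ : ℝ) : ℂ) * I by push_cast; ring,
          Complex.exp_ofReal_mul_I_re]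
      rw [e1, Complex.re_ofReal_mul, e2]
      ring
    simp_rw [hterm]
    rw [← Finset.mul_sum]
    have hc : 0 ≤ (Λ n : ℝ) * f (Real.log n) / n :=
      div_nonneg (mul_nonneg ArithmeticFunction.vonMangoldt_nonneg (hfnn _)) (Nat.cast_nonneg _)
    exact mul_nonneg hc (hb ψ)
  · -- `(n, q) > 1`: every `χ^j(n) = 0`
    have hnu : ¬ IsUnit (n : ZMod q) := (ZMod.isUnit_iff_coprime n q).not.2 hcop
    refine Finset.sum_nonneg fun j _ ↦ ?_
    rw [(χ ^ j).map_nonunit hnu]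
    simp

end KhaleEq81

end Literature.NumberTheory.LFunctions
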